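import Mathlib
import Literature.Analysis.FluidPDE.StationaryEulerWavePackets
import Summits.AnomalousDissipation.AnomalousDissipation.Theorems.PointSinkPointFluxConeBoxIterationTools
import Summits.AnomalousDissipation.AnomalousDissipation.Theorems.PointSinkPointFluxConeWildBoxLimitIBP
import Summits.AnomalousDissipation.AnomalousDissipation.Theorems.PointSinkPointFluxConeWildBoxLimitTools1
import HarnessLib

/-!
# The stub `stub_wildBoxLimitTools` (crux `PointSink.PointFluxCone`, stmt-AnomalousDissipation-19033,
line `Sketch`): the a.e. limit of the box iteration, with pressure

The `ℝ³`-box version of the tree's `Literature/Analysis/FluidPDE/StationaryEulerLimit.lean`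
(Choffrut–Székelyhidi 2014, §2 Step 3 and Lemma 2). From the output of the explicit box iteration
(smooth states `w_k` and pressures `π_k` vanishing off the unit box, `w_k(x) ∈ 𝒰_{e(x)}`, pressure
increments `≤ δ 2^{-(k+1)}`, the classical identities `div v_k = 0`, `div (u_k + π_k I) = 0`, the
`L²` Cauchy property and vanishing defects) we extract an `L²`-fast subsequence converging a.e.
to a bounded measurable limit `w = (v, u)` vanishing off the box
(`PointSinkPointFluxConeWildBoxLimitTools1.lean`), the uniform limit `π` of the pressures, and pass
to the limit in the finite-stage weak identities (`PointSinkPointFluxConeWildBoxLimitIBP.lean`) by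
dominated convergence:

* `wildLim_inner_gradient`: `⟪v, ∇θ⟫ = Σᵢ vᵢ ∂ᵢθ`;
* `wildLim_tendsto_integral_vel`, `wildLim_tendsto_integral_str`: dominated convergence for the
  two weak pairings along an a.e. convergent bounded sequence;
* `stub_wildBoxLimitTools`: the registered sub-stub.

References: A. Choffrut, L. Székelyhidi Jr., SIAM J. Math. Anal. 46 (2014), §2 Step 3, Lemma 2.
-/

noncomputable section

open scoped InnerProductSpace ContDiff ENNReal Topology
open Set Function MeasureTheory Metric Filter
open Literature.Analysis.FluidPDE Literature.Analysis.FluidPDE.StationaryEuler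
open Literature.Analysis.FunctionSpaces

set_option linter.dupNamespace false

namespace Summit.AnomalousDissipation.AnomalousDissipation.Theorems

/-! ## The gradient pairing in coordinates -/

/-- `⟪v, ∇θ(x)⟫ = Σᵢ vᵢ ∂ᵢθ(x)`. [folklore] -/
theorem wildLim_inner_gradient (θ : Ed (Fin 3) → ℝ) (v x : Ed (Fin 3)) :
    ⟪v, gradient θ x⟫_ℝ = ∑ i, v i * pd (eb i) θ x := by
  rw [real_inner_comm, gradient, InnerProductSpace.toDual_symm_apply]
  conv_lhs => rw [← (EuclideanSpace.basisFun (Fin 3) ℝ).sum_repr v]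
  simp only [map_sum, map_smul, EuclideanSpace.basisFun_repr, EuclideanSpace.basisFun_apply,
    smul_eq_mul, pd_apply]

/-! ## Passing to the limit in the weak identities -/

/-- **Dominated convergence for `∫ ⟪v_k, ∇θ⟫`** along an a.e. convergent, uniformly bounded
sequence of continuous states. [folklore] -/
theorem wildLim_tendsto_integral_vel {w : ℕ → Ed (Fin 3) → State (Fin 3)}
    {wl : Ed (Fin 3) → State (Fin 3)} {R : ℝ} (hwc : ∀ k, Continuous (w k))
    (hR : ∀ k x, ‖w k x‖ ≤ R) (hl : ∀ᵐ x, Tendsto (fun k => w k x) atTop (𝓝 (wl x)))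
    {θ : Ed (Fin 3) → ℝ} (hθ : ContDiff ℝ ∞ θ) (hθc : HasCompactSupport θ) :
    Tendsto (fun k => ∫ x, ⟪vel (w k x), gradient θ x⟫_ℝ) atTop
      (𝓝 (∫ x, ⟪vel (wl x), gradient θ x⟫_ℝ)) := by
  -- adapted from Literature/Analysis/FluidPDE/StationaryEulerLimit.lean (`tendsto_integral_sum_coord_mul`)
  have hR0 : 0 ≤ R := (norm_nonneg _).trans (hR 0 0)
  have hac : ∀ i, Continuous (pd (eb i) θ) := fun i => continuous_pd (hθ.of_le one_le_infty') _
  have hai : ∀ i, Integrable fun x => R * ‖pd (eb i) θ x‖ := fun i =>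
    ((hac i).norm.const_mul R).integrable_of_hasCompactSupport
      ((hasCompactSupport_pd hθc _).norm.mul_left (f := fun _ => R))
  have hcoord : ∀ (s : State (Fin 3)) (c : Idx (Fin 3)), |s c| ≤ ‖s‖ := fun s c => by
    simpa using PiLp.norm_apply_le s c
  simp_rw [wildLim_inner_gradient, vel_apply]
  refine tendsto_integral_of_dominated_convergence (fun x => ∑ i, R * ‖pd (eb i) θ x‖)
    (fun k => ?_) (integrable_finsetSum _ fun i _ => hai i)
    (fun k => Eventually.of_forall fun x => ?_) ?_
  · exact (continuous_finsetSum _ fun i _ =>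
      (((PiLp.continuous_apply 2 (fun _ : Idx (Fin 3) => ℝ) (Sum.inl i)).comp (hwc k)).mul
        (hac i))).aestronglyMeasurable
  · rw [Real.norm_eq_abs]
    refine (Finset.abs_sum_le_sum_abs _ _).trans (Finset.sum_le_sum fun i _ => ?_)
    rw [abs_mul, Real.norm_eq_abs]
    exact mul_le_mul ((hcoord _ _).trans (hR k x)) le_rfl (abs_nonneg _) hR0
  · filter_upwards [hl] with x hx
    exact tendsto_finsetSum _ fun i _ =>
      ((((PiLp.continuous_apply 2 (fun _ : Idx (Fin 3) => ℝ) (Sum.inl i)).tendsto _).comp hx).mul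
        tendsto_const_nhds)

/-- **Dominated convergence for `∫ Σᵢⱼ (u_k + π_k I)ᵢⱼ bᵢⱼ`** along an a.e. convergent, uniformly
bounded sequence of continuous states and pointwise convergent, uniformly bounded pressures,
against continuous compactly supported coefficients. [folklore] -/
theorem wildLim_tendsto_integral_str {w : ℕ → Ed (Fin 3) → State (Fin 3)}
    {wl : Ed (Fin 3) → State (Fin 3)} {p : ℕ → Ed (Fin 3) → ℝ} {pl : Ed (Fin 3) → ℝ} {R δ : ℝ}
    (hwc : ∀ k, Continuous (w k)) (hpc : ∀ k, Continuous (p k)) (hR : ∀ k x, ‖w k x‖ ≤ R)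
    (hδ : ∀ k x, |p k x| ≤ δ) (hl : ∀ᵐ x, Tendsto (fun k => w k x) atTop (𝓝 (wl x)))
    (hpl : ∀ x, Tendsto (fun k => p k x) atTop (𝓝 (pl x))) {b : Fin 3 → Fin 3 → Ed (Fin 3) → ℝ}
    (hb : ∀ i j, Continuous (b i j)) (hbc : ∀ i j, HasCompactSupport (b i j)) :
    Tendsto (fun k => ∫ x, ∑ i, ∑ j, (str (w k x) i j + (if i = j then p k x else 0)) * b i j x)
      atTop (𝓝 (∫ x, ∑ i, ∑ j, (str (wl x) i j + (if i = j then pl x else 0)) * b i j x)) := by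
  have hδ0 : 0 ≤ δ := (abs_nonneg _).trans (hδ 0 0)
  have hbi : ∀ i j, Integrable fun x => (R + δ) * ‖b i j x‖ := fun i j =>
    ((hb i j).norm.const_mul _).integrable_of_hasCompactSupport
      ((hbc i j).norm.mul_left (f := fun _ => R + δ))
  have hq : ∀ k x i j, |str (w k x) i j + (if i = j then p k x else 0)| ≤ R + δ := by
    intro k x i j
    refine (abs_add_le _ _).trans (add_le_add ((abs_str_le_norm _ i j).trans (hR k x)) ?_)
    split_ifs
    · exact hδ k x
    · rw [abs_zero]; exact hδ0
  refine tendsto_integral_of_dominated_convergence (fun x => ∑ i, ∑ j, (R + δ) * ‖b i j x‖)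
    (fun k => ?_) (integrable_finsetSum _ fun i _ => integrable_finsetSum _ fun j _ => hbi i j)
    (fun k => Eventually.of_forall fun x => ?_) ?_
  · refine (continuous_finsetSum _ fun i _ => continuous_finsetSum _ fun j _ => ?_).aestronglyMeasurable
    exact (((continuous_str_apply i j).comp (hwc k)).add
      ((hpc k).if_const _ continuous_const)).mul (hb i j)
  · rw [Real.norm_eq_abs]
    refine (Finset.abs_sum_le_sum_abs _ _).trans (Finset.sum_le_sum fun i _ =>
      (Finset.abs_sum_le_sum_abs _ _).trans (Finset.sum_le_sum fun j _ => ?_))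
    rw [abs_mul, Real.norm_eq_abs]
    exact mul_le_mul_of_nonneg_right (hq k x i j) (abs_nonneg _)
  · filter_upwards [hl] with x hx
    refine tendsto_finsetSum _ fun i _ => tendsto_finsetSum _ fun j _ => ?_
    refine ((((continuous_str_apply i j).tendsto _).comp hx).add ?_).mul tendsto_const_nhds
    split_ifs
    · exact hpl x
    · exact tendsto_const_nhds

/-! ## The registered sub-stub -/

/-- **The a.e. limit of the box iteration, with pressure** (registered sub-stub
`stub_wildBoxLimitTools` of `stub_wildBox`, line `Sketch`): along an `L²`-fast subsequence the
states converge a.e. to a bounded measurable `w = (v, u)` vanishing off the box, the pressures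
converge uniformly to a continuous `π`, `|π| ≤ δ`; `w(x) ∈ 𝒦_{|v(x)|²}` a.e., `|v|² = e` a.e. on
the box, and the weak identities `div v = 0`, `div (u + π I) = 0` hold on `ℝ³`.
[cite: ChoffrutSzekelyhidi2014, §2 Step 3 and Lemma 2] -/
theorem stub_wildBoxLimitTools :
    (∀ (e : Ed (Fin 3) → ℝ) (ebar δ : ℝ) (w : ℕ → Ed (Fin 3) → State (Fin 3)) (π : ℕ → Ed (Fin 3) → ℝ),
      Continuous e → (∀ x, e x ≤ ebar) → 0 < δ →
      (∀ k, ContDiff ℝ ∞ (w k)) → (∀ k, ContDiff ℝ ∞ (π k)) →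
      (∀ k x, x ∉ box (Fin 3) → w k x = 0 ∧ π k x = 0) →
      (∀ k x, w k x ∈ HighDim.U (e x)) →
      (π 0 = fun _ => 0) → (∀ k x, |π (k + 1) x - π k x| ≤ δ / 2 ^ (k + 1)) →
      (∀ k x, ∑ i, pd (eb i) (fun y => vel (w k y) i) x = 0) →
      (∀ k x i, ∑ j, pd (eb j) (fun y => str (w k y) i j + (if i = j then π k y else 0)) x = 0) →
      (∀ η : ℝ, 0 < η → ∃ M : ℕ, ∀ n n', M ≤ n → n ≤ n' → ∫ x, ‖w n' x - w n x‖ ^ 2 < η) →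
      Tendsto (fun k => ∫ x in box (Fin 3), (e x - ‖vel (w k x)‖ ^ 2)) atTop (𝓝 0) →
      ∃ (wl : Ed (Fin 3) → State (Fin 3)) (πl : Ed (Fin 3) → ℝ) (ns : ℕ → ℕ), StrictMono ns ∧
        Measurable wl ∧ Continuous πl ∧
        (∀ x, ‖wl x‖ ≤ Real.sqrt ebar + 9 * ebar) ∧ (∀ x, |πl x| ≤ δ) ∧
        (∀ x, x ∉ box (Fin 3) → wl x = 0 ∧ πl x = 0) ∧
        (∀ᵐ x, Tendsto (fun i => w (ns i) x) atTop (𝓝 (wl x))) ∧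
        (∀ x, Tendsto (fun k => π k x) atTop (𝓝 (πl x))) ∧
        (∀ᵐ x, wl x ∈ K (‖vel (wl x)‖ ^ 2)) ∧
        (∀ᵐ x, x ∈ box (Fin 3) → ‖vel (wl x)‖ ^ 2 = e x) ∧
        (∀ θ : Ed (Fin 3) → ℝ, ContDiff ℝ ∞ θ → HasCompactSupport θ →
          ∫ x, ⟪vel (wl x), gradient θ x⟫_ℝ = 0) ∧
        (∀ Φ : Ed (Fin 3) → Ed (Fin 3), ContDiff ℝ ∞ Φ → HasCompactSupport Φ →
          ∫ x, ∑ i, ∑ j, (str (wl x) i j + (if i = j then πl x else 0)) * pd (eb j) (fun y => Φ y i) x = 0)) := by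
  intro e ebar δ w π he hebar hδ hw hπ hoff hU hπ0 hπinc hdiv hstr hcauchy hdefect
  -- uniform bound, continuity, support
  have hR : ∀ k x, ‖w k x‖ ≤ Real.sqrt ebar + 9 * ebar := fun k x => by
    have h := boxIter_norm_le_of_mem_U (hebar x) (hU k x)
    linarith
  have hwc : ∀ k, Continuous (w k) := fun k => (hw k).continuous
  have hw0 : ∀ k x, x ∉ box (Fin 3) → w k x = 0 := fun k x hx => (hoff k x hx).1
  -- subsequence, limit, pressure, defect
  obtain ⟨ns, hns, hae⟩ := wildLim_exists_subseq hwc hw0 hcauchy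
  obtain ⟨wl, hwlm, hwlR, hwl0, hl⟩ := wildLim_modify (w := fun i => w (ns i)) (fun i => hwc _)
    (fun i x => hR _ x) (fun i x hx => hw0 _ x hx) hae
  obtain ⟨hπbd, πl, hπlc, hπlδ, hπl⟩ :=
    wildLim_pressure hδ.le (fun k => (hπ k).continuous) hπ0 hπinc
  obtain ⟨hCl, hvel⟩ := wildLim_ae_norm_vel_sq (w := fun i => w (ns i)) he hebar (fun i => hwc _)
    (fun i x => hR _ x) (fun i x => HighDim.U_subset_C _ (hU _ x)) hl
    (hdefect.comp hns.tendsto_atTop)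
  refine ⟨wl, πl, ns, hns, hwlm, hπlc, hwlR, hπlδ, fun x hx => ⟨hwl0 x hx, ?_⟩, hl, hπl, ?_, hvel,
    fun θ hθ hθc => ?_, fun Φ hΦ hΦc => ?_⟩
  · -- the pressure vanishes off the box
    have h := hπl x
    rw [show (fun k => π k x) = fun _ => (0 : ℝ) from funext fun k => (hoff k x hx).2] at h
    exact tendsto_nhds_unique h tendsto_const_nhds
  · -- `w(x) ∈ 𝒦_{|v(x)|²}` a.e.
    filter_upwards [hCl, hvel] with x hC hv
    by_cases hxb : x ∈ box (Fin 3)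
    · rw [hv hxb]; exact mem_K_of_mem_C_of_norm_sq_eq hC (hv hxb)
    · rw [hwl0 x hxb]; exact wildLim_zero_mem_K
  · -- weak `div v = 0`
    have h := wildLim_tendsto_integral_vel (w := fun i => w (ns i)) (fun i => hwc _)
      (fun i x => hR _ x) hl hθ hθc
    have h0 : ∀ i, ∫ x, ⟪vel (w (ns i) x), gradient θ x⟫_ℝ = 0 := fun i =>
      wildBoxIBP_vel (hw _) (hw0 _) (hdiv _) hθ
    simp only [h0] at h
    exact tendsto_nhds_unique h tendsto_const_nhds
  · -- weak `div (u + π I) = 0`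
    have hΦi : ∀ i, ContDiff ℝ ∞ fun y => Φ y i := fun i => contDiff_euclidean.1 hΦ i
    have hΦic : ∀ i, HasCompactSupport fun y => Φ y i := fun i =>
      hΦc.comp_left (g := fun v : Ed (Fin 3) => v i) (by simp)
    have h := wildLim_tendsto_integral_str (w := fun i => w (ns i)) (p := fun i => π (ns i))
      (fun i => hwc _) (fun i => (hπ _).continuous) (fun i x => hR _ x) (fun i x => hπbd _ x) hl
      (fun x => (hπl x).comp hns.tendsto_atTop) (b := fun i j => pd (eb j) fun y => Φ y i)
      (fun i j => continuous_pd ((hΦi i).of_le one_le_infty') _)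
      (fun i j => hasCompactSupport_pd (hΦic i) _)
    have h0 : ∀ i, ∫ x, ∑ a, ∑ b, (str (w (ns i) x) a b + (if a = b then π (ns i) x else 0)) *
        pd (eb b) (fun y => Φ y a) x = 0 := fun i =>
      wildBoxIBP_str (hw _) (hπ _) (hw0 _) (fun x hx => (hoff _ x hx).2) (hstr _) hΦ
    simp only [h0] at h
    exact tendsto_nhds_unique h tendsto_const_nhds

end Summit.AnomalousDissipation.AnomalousDissipation.Theorems

end
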